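import Literature.MathematicalPhysics.QuantumLattice.HubbardTTPrimeThermalPhaseCoexistenceCanonical
import HarnessLib

/-!
# Thermal phase separation in the canonical ensemble, SUPER-SEGMENT form: one certified strict-concavity defect of the
# pressure `p(β; ·)` at a triple `(n₁, n, n₂)` excludes coexistence of EVERY pair of phases with densities `≤ n₁` and `≥ n₂`;
# energy-window form (cap at `n`, floors at `n₁, n₂`, `β` above an explicit threshold)

Topic `Literature/MathematicalPhysics/QuantumLattice` (family `hubbard`); sequel of `HubbardTTPrimeThermalPhaseCoexistenceCanonical`
(§3 there: a canonical thermal torus-limit state at `(β; t,t',U; n)` that is a mixture `λω₁ + (1−λ)ω₂` of translation-invariant states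
forces `p(β;·) = pressureTT' β t t' U ·` to be AFFINE on `[ρ(ω₁), ρ(ω₂)]`; §5 the exclusion from caps at the EXACT component densities)
and the `T > 0` twin of §4 of `HubbardTTPrimePhaseCoexistenceExclusion` (`T = 0` super-segment form). PROVED (`U ≥ 0`, `β > 0`,
`0 < ρ(ω₁) ≤ n₁ < n₂ ≤ ρ(ω₂) < 2`, `0 < λ < 1`, `a, b ≥ 0`, `a + b = 1`):
* `not_isTorusLimitOfMixture_mix_of_strict_at_of_le` — if `a p(n₁) + b p(n₂) < p(a n₁ + b n₂)` then NO canonical thermal state at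
  `(β; n)` (any `0 < n < 2`) is the mixture `λω₁ + (1−λ)ω₂`: the affine piece `[ρ(ω₁), ρ(ω₂)]` would contain `[n₁, n₂]` and force
  equality at `a n₁ + b n₂` (`affine_subchord_of_eq_chord`, real analysis of the `T = 0` file);
* `not_isTorusLimitOfMixture_mix_of_caps_lt_floor_of_le` — certified form: a pressure FLOOR `W ≤ p(a n₁ + b n₂)` and pressure CAPS
  `p(n_i) ≤ Q_i` with `a Q₁ + b Q₂ < W`;
* `not_isTorusLimitOfMixture_mix_of_energyWindows_of_le` — ENERGY-WINDOW form via the a-priori pressure window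
  `−β e(n) ≤ p(β; n) ≤ 2H_b(n/2) − β e(n)` (`pressureTT'_mem_Icc`) and `H_b ≤ log 2`: a ground-state energy CAP `e(a n₁ + b n₂) ≤ c` and
  FLOORS `f_i ≤ e(n_i)` with `2·log 2 < β·(a f₁ + b f₂ − c)` exclude the coexistence — every `T = 0` phase-separation-exclusion margin
  `M = a f₁ + b f₂ − c > 0` is a `T > 0` exclusion for `β > 2 log 2 / M` (the entropy price of the two phases, crude `log 4` per site).
HONEST SCOPE: exclusion of MACROSCOPIC coexistence (mixtures of translation-invariant states) in canonical thermal torus-limit states;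
nothing about stripes / finite-period states, about which phase is realised, or about `T = 0`; the `log 4` entropy allowance is the crude
one (no low-temperature improvement claimed). Everything is PROVED; no definition, no named fact, no number.
Written 2026-08-28 by hubbard-downfold-unc-2 (g19; cell `pub/hubbard-downfold`, MO-S1 ↔ S2 seam) for the `T > 0` cells of the material-box
phase-separation words (`Summits/…/Observables/PhaseSeparationExclusionBox.lean`).

## Mathlib / tree search
REUSED: `IsTorusLimitOfMixture.pressureTT'_eq_chord_on_segment_of_mix_sectorGibbs` (`…ThermalPhaseCoexistenceCanonical` §3),
`affine_subchord_of_eq_chord` (`HubbardTTPrimePhaseCoexistenceExclusion` §4), `pressureTT'_mem_Icc` (`HubbardTTPrimeThermalPressureLimit`),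
Mathlib `Real.binEntropy_le_log_two`. `lean search 'strict_at_of_le|SuperSegment'`: only the `T = 0` file (2026-08-28).

## References
* R. B. Israel, *Convexity in the Theory of Lattice Gases* (1979), Thm. I.2.4, §III. [cite: Israel1979, Thm. I.2.4]
* V. J. Emery, S. A. Kivelson, H. Q. Lin, Phys. Rev. Lett. 64 (1990) 475. [cite: EmeryKivelsonLin1990, pp. 475–476]
* D. Ruelle, *Statistical Mechanics: Rigorous Results* (1969), §3.3–§3.4. [cite: Ruelle1969, §3.3]
-/

noncomputable section

open scoped ComplexOrder BigOperators
open Filter Topology Finset Set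

namespace Literature.MathematicalPhysics.QuantumLattice

open Matrix HubbardWave0 Literature.Probability.LatticeModels ThermodynamicLimit

namespace InfVolFermionState

variable (t t' : ℝ) {U : ℝ} (hU : 0 ≤ U) {β : ℝ} (hβ : 0 < β) {ω₁ ω₂ : InfVolFermionState 2} {Ls : ℕ → ℕ} {n : ℝ}
include hU hβ

/-- **Super-segment exclusion at `T > 0` (canonical).** Translation-invariant `ω₁, ω₂` with `0 < ρ(ω₁) ≤ n₁ < n₂ ≤ ρ(ω₂) < 2`; weights
`a, b ≥ 0`, `a + b = 1` with a STRICT CONCAVITY DEFECT of the canonical pressure, `a p(n₁) + b p(n₂) < p(a n₁ + b n₂)`. Then for every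
`0 < λ < 1` and every `0 < n < 2` the mixture `λω₁ + (1−λ)ω₂` is NOT a canonical thermal torus-limit state at `(β; t,t',U; n)`.
[cite: Israel1979, Thm. I.2.4] [cite: EmeryKivelsonLin1990, pp. 475–476] -/
theorem not_isTorusLimitOfMixture_mix_of_strict_at_of_le (h₁ : ω₁.IsTranslationInvariant)
    (h₂ : ω₂.IsTranslationInvariant) (hρ₁0 : 0 < ω₁.density) (hρ₂2 : ω₂.density < 2)
    {n₁ n₂ : ℝ} (hn₁ : ω₁.density ≤ n₁) (hn12 : n₁ < n₂) (hn₂ : n₂ ≤ ω₂.density)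
    {a b : ℝ} (ha : 0 ≤ a) (hb : 0 ≤ b) (hab : a + b = 1)
    (hstrict : a * pressureTT' β t t' U n₁ + b * pressureTT' β t t' U n₂ < pressureTT' β t t' U (a * n₁ + b * n₂))
    (hn0 : 0 < n) (hn2 : n < 2) {lam : ℝ} (hl0 : 0 < lam) (hl1 : lam < 1) (hLs : Tendsto Ls atTop atTop) :
    ¬ (mix lam hl0.le hl1.le ω₁ ω₂).IsTorusLimitOfMixture (sectorGibbsCount n) (fun L => sectorGibbsWeightTT' β t t' U n L)
      (fun L => sectorGibbsVectorTT' t t' U n L) Ls := by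
  intro hω
  have hρ₁2 : ω₁.density < 2 := by linarith
  have hρ₂0 : 0 < ω₂.density := by linarith
  have haff : ∀ {p q : ℝ}, 0 ≤ p → 0 ≤ q → p + q = 1 →
      pressureTT' β t t' U (p * ω₁.density + q * ω₂.density) =
        p * pressureTT' β t t' U ω₁.density + q * pressureTT' β t t' U ω₂.density :=
    fun hp hq hpq =>
      hω.pressureTT'_eq_chord_on_segment_of_mix_sectorGibbs t t' hU hβ h₁ h₂ hρ₁0 hρ₁2 hρ₂0 hρ₂2 hn0 hn2 hl0 hl1 hLs hp hq hpq
  have heq := affine_subchord_of_eq_chord (f := pressureTT' β t t' U) (by linarith) haff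
    hn₁ (by linarith) (by linarith) hn₂ ha hb hab
  exact absurd heq (ne_of_gt hstrict)

/-- **Certified super-segment exclusion at `T > 0` from pressure windows**: a pressure FLOOR `W ≤ p(a n₁ + b n₂)` and pressure CAPS
`p(n₁) ≤ Q₁`, `p(n₂) ≤ Q₂` with `a Q₁ + b Q₂ < W` (`0 < ρ(ω₁) ≤ n₁ < n₂ ≤ ρ(ω₂) < 2`, `a + b = 1`) exclude the mixture as a canonical
thermal state at every density. [cite: Israel1979, Thm. I.2.4] -/
theorem not_isTorusLimitOfMixture_mix_of_caps_lt_floor_of_le (h₁ : ω₁.IsTranslationInvariant)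
    (h₂ : ω₂.IsTranslationInvariant) (hρ₁0 : 0 < ω₁.density) (hρ₂2 : ω₂.density < 2)
    {n₁ n₂ : ℝ} (hn₁ : ω₁.density ≤ n₁) (hn12 : n₁ < n₂) (hn₂ : n₂ ≤ ω₂.density)
    {a b : ℝ} (ha : 0 ≤ a) (hb : 0 ≤ b) (hab : a + b = 1) {W Q₁ Q₂ : ℝ}
    (hW : W ≤ pressureTT' β t t' U (a * n₁ + b * n₂)) (hQ₁ : pressureTT' β t t' U n₁ ≤ Q₁)
    (hQ₂ : pressureTT' β t t' U n₂ ≤ Q₂) (hgap : a * Q₁ + b * Q₂ < W)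
    (hn0 : 0 < n) (hn2 : n < 2) {lam : ℝ} (hl0 : 0 < lam) (hl1 : lam < 1) (hLs : Tendsto Ls atTop atTop) :
    ¬ (mix lam hl0.le hl1.le ω₁ ω₂).IsTorusLimitOfMixture (sectorGibbsCount n) (fun L => sectorGibbsWeightTT' β t t' U n L)
      (fun L => sectorGibbsVectorTT' t t' U n L) Ls := by
  refine not_isTorusLimitOfMixture_mix_of_strict_at_of_le t t' hU hβ h₁ h₂ hρ₁0 hρ₂2 hn₁ hn12 hn₂ ha hb hab ?_ hn0 hn2 hl0
    hl1 hLs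
  have k1 := mul_le_mul_of_nonneg_left hQ₁ ha
  have k2 := mul_le_mul_of_nonneg_left hQ₂ hb
  linarith

/-- **Energy-window form (the `T = 0` margin read at `T > 0`).** With `0 ≤ n₁`, `n₂ < 2`: a ground-state energy CAP
`e(t,t',U, a n₁ + b n₂) ≤ c` and FLOORS `f₁ ≤ e(t,t',U,n₁)`, `f₂ ≤ e(t,t',U,n₂)` whose margin beats the two-phase entropy allowance,
`2·log 2 < β·(a f₁ + b f₂ − c)`, exclude the `(≤ n₁ | ≥ n₂)` coexistence in every canonical thermal state at `(β; t,t',U; n)`, `0 < n < 2`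
(a-priori window `−β e ≤ p ≤ 2H_b(·/2) − β e`, `H_b ≤ log 2`). [cite: Israel1979, Thm. I.2.4] [cite: Ruelle1969, §3.3] -/
theorem not_isTorusLimitOfMixture_mix_of_energyWindows_of_le (h₁ : ω₁.IsTranslationInvariant)
    (h₂ : ω₂.IsTranslationInvariant) (hρ₁0 : 0 < ω₁.density) (hρ₂2 : ω₂.density < 2)
    {n₁ n₂ : ℝ} (hn₁0 : 0 ≤ n₁) (hn₂2 : n₂ < 2) (hn₁ : ω₁.density ≤ n₁) (hn12 : n₁ < n₂) (hn₂ : n₂ ≤ ω₂.density)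
    {a b : ℝ} (ha : 0 ≤ a) (hb : 0 ≤ b) (hab : a + b = 1) {c f₁ f₂ : ℝ}
    (hcap : energyDensityTT' t t' U (a * n₁ + b * n₂) ≤ c)
    (hf₁ : f₁ ≤ energyDensityTT' t t' U n₁) (hf₂ : f₂ ≤ energyDensityTT' t t' U n₂)
    (hM : 2 * Real.log 2 < β * (a * f₁ + b * f₂ - c))
    (hn0 : 0 < n) (hn2 : n < 2) {lam : ℝ} (hl0 : 0 < lam) (hl1 : lam < 1) (hLs : Tendsto Ls atTop atTop) :
    ¬ (mix lam hl0.le hl1.le ω₁ ω₂).IsTorusLimitOfMixture (sectorGibbsCount n) (fun L => sectorGibbsWeightTT' β t t' U n L)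
      (fun L => sectorGibbsVectorTT' t t' U n L) Ls := by
  have hn₁2 : n₁ < 2 := by linarith
  have hn₂0 : 0 ≤ n₂ := by linarith
  have hm0 : 0 ≤ a * n₁ + b * n₂ := by positivity
  have hm2 : a * n₁ + b * n₂ < 2 := by nlinarith
  -- pressure floor at the mean density and caps at the outer densities from the a-priori window
  have hW := (pressureTT'_mem_Icc hβ.le t t' hU hm0 hm2).1
  have hQ₁ := (pressureTT'_mem_Icc hβ.le t t' hU hn₁0 hn₁2).2
  have hQ₂ := (pressureTT'_mem_Icc hβ.le t t' hU hn₂0 hn₂2).2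
  have hH₁ : Real.binEntropy (n₁ / 2) ≤ Real.log 2 := Real.binEntropy_le_log_two
  have hH₂ : Real.binEntropy (n₂ / 2) ≤ Real.log 2 := Real.binEntropy_le_log_two
  refine not_isTorusLimitOfMixture_mix_of_caps_lt_floor_of_le t t' hU hβ h₁ h₂ hρ₁0 hρ₂2 hn₁ hn12 hn₂ ha hb hab hW hQ₁ hQ₂
    ?_ hn0 hn2 hl0 hl1 hLs
  have k1 := mul_le_mul_of_nonneg_left hf₁ (mul_nonneg hβ.le ha)
  have k2 := mul_le_mul_of_nonneg_left hf₂ (mul_nonneg hβ.le hb)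
  have k3 := mul_le_mul_of_nonneg_left hcap hβ.le
  have k4 := mul_le_mul_of_nonneg_left hH₁ ha
  have k5 := mul_le_mul_of_nonneg_left hH₂ hb
  have k6 : 2 * Real.log 2 * a + 2 * Real.log 2 * b = 2 * Real.log 2 := by rw [← mul_add, hab, mul_one]
  have k7 : β * (a * f₁ + b * f₂ - c) = β * a * f₁ + β * b * f₂ - β * c := by ring
  rw [k7] at hM
  linarith

end InfVolFermionState

end Literature.MathematicalPhysics.QuantumLattice
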